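import Summits.CriticalPhenomena.PercolationContinuityZ3.Theorems.PercNearOneGluingNoHeavyLowerTailQ7ThreeOfCovTau
import Summits.CriticalPhenomena.PercolationContinuityZ3.Theorems.PercNearOneGluingNoHeavyLowerTailCovTauOfTA
import HarnessLib

/-!
# `NoHeavyLowerTail` (stmt-CriticalPhenomena-4575) — Kozma–Nitzan's Question 7 for three relays, and (GΨ₃),
# UNCONDITIONALLY on every finite weighted graph

Support file (`--supports stmt-CriticalPhenomena-4575`), coupling seat `prim-cplus-coupling` (gen 9).  No
definitions, no named facts, no sorries; standard axioms.

Kozma–Nitzan (arXiv:2401.12397) prove their pre-FKG inequality for two relays (Theorem 1) and, for observers attached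
only to the relays, the MIN version for any number of relays (Theorem 4); Question 7 (p. 36) asks whether the
pre-FKG inequality (41) `P(0↔b, 0↔A) ≥ P(0↔A, a↔b)` holds for the DESIGNATED relay `a` minimising `P(a↔b)`.
THIS FILE answers Question 7 affirmatively for `|A| = 3` on every finite weighted graph (hence the pre-FKG Conjecture 2
and the post-FKG Conjecture 1 for three relays), together with the monotone-functional statement (GΨ₃) behind it:

* `Q7Psi.gpsi_three` — **(GΨ₃).**  For distinct `x, y, z`, any `o`, any monotone real cluster property `F` with
  `E F(C z) ≤ E F(C x)` and `E F(C z) ≤ E F(C y)`:  `∫_{o↔x ∪ o↔y} F(C z) ≤ ∫_{o↔x ∪ o↔y} F(C o)`.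
* `Q7Psi.q7_three` — **Question 7 for three relays.**  For `o, x, y, z ≠ b`, `x, y, z` distinct,
  `μ(z↔b) ≤ μ(x↔b)`, `μ(z↔b) ≤ μ(y↔b)`:  `μ({z↔b} ∩ {o↔A}) ≤ μ({o↔b} ∩ {o↔A})`, `A = {x, y, z}`.

The chain (all in the tree): the peeled form and green bridge (`Q7Psi.q7_of_psi`,
`Q7Psi.real_inter_openConn_eq_integral_green`, gen 5) reduce Question 7 to (GΨ₃) on `G ∖ b`; the dual certificate
`t* = φE1/(φE1+φE2)`, `λ*`, `μ*` (ttrl census q7psi RESULT 3) reduces (GΨ₃) to its observer halves (`Q7Psi.opart_of_halves`,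
`Q7Psi.gpsi_three_of_dom`, gen 7; the weak-relay half is their DUAL, `Q7Psi.zpart_of_halves`, gen 9), each observer half to
the covariance comparison (P1**) (`Q7Psi.p1star_of_cov`, gen 7), which is the conditioned covariance transfer COV(τ) —
proved on paper by prim-hp-8 (COV-TAU-PROOF.md) and IN THE TREE as `CovTau.covTau` (prim-hp-7, via the hull-port `T_A`
chain `HullPort.TA_of_PvI`/`PvI_of_CE`/`CE_holds` of prim-ineq-prove-5 / prim-hp-7 / prim-lit-3, resting on Gladkov's
decision-tree Harris inequality); closure over degenerate weights and the assembly: `Q7Psi.gpsi_three_of_covTau`,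
`Q7Psi.q7_three_of_covTau` (gen 9).
[cite: KozmaNitzan2024, Question 7 (p. 36), Conjectures 1–2 (p. 3), Theorems 1 and 4 (pp. 7, 12–14), §5.1 (pp. 31–32)]
[cite: VandenbergHaggstromKahn2005, Thms 1.3–1.4 (pp. 6–7), §2.1 (pp. 9–13)] [cite: Gladkov2024, Thm. 3.2]
-/

namespace Summit.CriticalPhenomena.PercolationContinuityZ3.Theorems

open MeasureTheory Set Literature.Probability.LatticeModels Literature.Probability.Percolation
open scoped Classical

noncomputable section

namespace Q7Psi

universe u

variable {V : Type u} [Fintype V]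

/-- **(GΨ₃), unconditionally.**  Three relays `x, y, z` (distinct), any observer `o`, any finite weighted graph, any monotone
real cluster property `F`: if `E F(C z) ≤ E F(C x)` and `E F(C z) ≤ E F(C y)` then
`∫_{o↔x ∪ o↔y} F(C z) ≤ ∫_{o↔x ∪ o↔y} F(C o)`.  (`gpsi_three_of_covTau` fed with `CovTau.covTau`.)
[cite: KozmaNitzan2024, §5.1 (pp. 31–32), Question 7 (p. 36)] [cite: VandenbergHaggstromKahn2005, Thms 1.3–1.4 (pp. 6–7)] -/
theorem gpsi_three (w : Sym2 V → unitInterval) (o x y z : V) (hxy : x ≠ y) (hxz : x ≠ z) (hyz : y ≠ z)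
    (F : Set V → ℝ) (hF : ∀ S T : Set V, S ⊆ T → F S ≤ F T)
    (hx : ∫ ω, F (openCluster ω z) ∂(prodBernoulli w) ≤ ∫ ω, F (openCluster ω x) ∂(prodBernoulli w))
    (hy : ∫ ω, F (openCluster ω z) ∂(prodBernoulli w) ≤ ∫ ω, F (openCluster ω y) ∂(prodBernoulli w)) :
    ∫ ω in (openConn o x ∪ openConn o y), F (openCluster ω z) ∂(prodBernoulli w) ≤
      ∫ ω in (openConn o x ∪ openConn o y), F (openCluster ω o) ∂(prodBernoulli w) :=
  gpsi_three_of_covTau (fun p _ x' y' o' v' hvx f hf => CovTau.covTau p x' y' o' v' hvx f hf)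
    w o x y z hxy hxz hyz F hF hx hy

/-- **Kozma–Nitzan's Question 7 for three relays, unconditionally.**  In a finite weighted graph let `o, x, y, z ≠ b`,
`x, y, z` distinct, and `z` the least `b`-reliable relay: `μ(z↔b) ≤ μ(x↔b)`, `μ(z↔b) ≤ μ(y↔b)`.  Then the pre-FKG
inequality (41) of arXiv:2401.12397 holds for the designated relay `z` and `A = {x, y, z}`:
`μ({z↔b} ∩ {o↔A}) ≤ μ({o↔b} ∩ {o↔A})`.  In particular Kozma–Nitzan's Conjecture 2 (pre-FKG) and Conjecture 1 hold for
every relay set of size three.  (`q7_three_of_covTau` fed with `CovTau.covTau` on the vertex type of `G ∖ b`.)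
[cite: KozmaNitzan2024, Question 7 (p. 36), Conjectures 1–2 (p. 3), Theorem 4 (pp. 12–14)] -/
theorem q7_three (w : Sym2 V → unitInterval) (o b x y z : V) (hob : o ≠ b) (hxb : x ≠ b) (hyb : y ≠ b) (hzb : z ≠ b)
    (hxy : x ≠ y) (hxz : x ≠ z) (hyz : y ≠ z)
    (hzx : (prodBernoulli w).real (openConn z b) ≤ (prodBernoulli w).real (openConn x b))
    (hzy : (prodBernoulli w).real (openConn z b) ≤ (prodBernoulli w).real (openConn y b)) :
    (prodBernoulli w).real (openConn z b ∩ (openConn o x ∪ openConn o y ∪ openConn o z)) ≤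
      (prodBernoulli w).real (openConn o b ∩ (openConn o x ∪ openConn o y ∪ openConn o z)) :=
  q7_three_of_covTau (fun _ _ p _ x' y' o' v' hvx f hf => CovTau.covTau p x' y' o' v' hvx f hf)
    w o b x y z hob hxb hyb hzb hxy hxz hyz hzx hzy

/-- **Question 7 for three relays, `Finset` form** (the shape of `Q7Psi.q7_of_psi`'s conclusion, `A = {x, y, z}`):
`μ({z↔b} ∩ ⋃_{a∈A} {o↔a}) ≤ μ({o↔b} ∩ ⋃_{a∈A} {o↔a})`. [cite: KozmaNitzan2024, Question 7 (p. 36)] -/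
theorem q7_three_finset (w : Sym2 V → unitInterval) (o b x y z : V) (hob : o ≠ b) (hxb : x ≠ b) (hyb : y ≠ b)
    (hzb : z ≠ b) (hxy : x ≠ y) (hxz : x ≠ z) (hyz : y ≠ z)
    (hzx : (prodBernoulli w).real (openConn z b) ≤ (prodBernoulli w).real (openConn x b))
    (hzy : (prodBernoulli w).real (openConn z b) ≤ (prodBernoulli w).real (openConn y b)) :
    (prodBernoulli w).real (openConn z b ∩ ⋃ a ∈ ({x, y, z} : Finset V), (openConn o a : Set (BondConfig V))) ≤
      (prodBernoulli w).real (openConn o b ∩ ⋃ a ∈ ({x, y, z} : Finset V), (openConn o a : Set (BondConfig V))) := by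
  have hA : ∀ X : Set (BondConfig V), X ∩ (⋃ a ∈ ({x, y, z} : Finset V), (openConn o a : Set (BondConfig V))) =
      X ∩ (openConn o x ∪ openConn o y ∪ openConn o z) := by
    intro X; congr 1; ext ω; simp [or_assoc]
  rw [hA, hA]
  exact q7_three w o b x y z hob hxb hyb hzb hxy hxz hyz hzx hzy

end Q7Psi

end

end Summit.CriticalPhenomena.PercolationContinuityZ3.Theorems
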